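import Summits.ValiantsHypothesis.ValiantsHypothesis.Theses.AnyonJets
import Summits.ValiantsHypothesis.ValiantsHypothesis.Theorems.AnyonJetsTwoAdicShadow
import Literature.Computability.AlgebraicComplexity.PermanentBitsPPoly
import Literature.Computability.AlgebraicComplexity.SkewCircuitFormalDegree
import Literature.Computability.AlgebraicComplexity.FermionicPencil
import Literature.Computability.AlgebraicComplexity.BurgisserThm41OneProofs

/-!
# AnyonJets, support item `BooleanShadowToCF` (stmt-ValiantsHypothesis-16744) — PROVED

Route `AnyonJets` of `ValiantsHypothesis`, support item `BooleanShadowToCF`: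
`PerModPowBooleanHard → ConstantFreeJetGrowth` — "the Boolean far side implies constant-free jet
growth".  We prove the contrapositive exactly as the planner sketched it: if for some `c` every
fixed jet `J_{n,j}` (`j ≥ 1`) had constant-free complexity `< n^c` eventually, then for each `k ≥ 1`
the polynomial `S = Σ_{j<k} (−2)^j J_{n,j}` — which is `≡ per_n (mod 2^k)` by the proved item
`TwoAdicShadow` (`twoAdicShadow_proof`), and whose `j = 0` term is the determinant, constant-free
in `4(n+1)^4` (`constantFreeComplexity_detPoly_le`, Mahajan–Vinay) — has constant-free complexity
`≤ 4(n+1)^4 + k n^c + O(k²)`, and Bürgisser's Boolean simulation modulo `2^k`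
(`cktSize_testBits_aeval_eval`, `cktSize_inputResidue`) computes the `k` low bits of
`per(y) = #{σ : y(σ j, j) = 1 ∀ j}` (`aeval_perPoly_bool`) by `B₂`-circuits of size `≤ n^{c+7}`
for all large `n` — contradicting `PerModPowBooleanHard` at the exponent `c + 7`.
Honest framing: bookkeeping on a dormant route; VP ≠ VNP is NOT proved and nothing here is progress
on it.
-/

noncomputable section

-- layout Summits/ValiantsHypothesis/ValiantsHypothesis forces the duplicated namespace component
set_option linter.dupNamespace false

namespace Summit.ValiantsHypothesis.ValiantsHypothesis.Theorems.AnyonJets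

open Literature.Computability.AlgebraicComplexity Literature.Computability.Complexity MvPolynomial
  ArithCircuit Finset

/-! ### Constant-free cost of the scalars `(−2)^m` and of the jet sum -/

/-- `τ(2^m) ≤ 2m + 1` (`2 = 1 + 1`, then `m` multiplications). -/
theorem constantFreeComplexity_C_two_pow_le {σ : Type*} (m : ℕ) :
    constantFreeComplexity (C ((2 : ℤ) ^ m) : MvPolynomial σ ℤ) ≤ 2 * m + 1 := by
  induction m with
  | zero => rw [pow_zero, C_1, constantFreeComplexity_one]; exact Nat.zero_le _
  | succ m ih =>
    rw [pow_succ, C_mul]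
    have h2 : constantFreeComplexity (C (2 : ℤ) : MvPolynomial σ ℤ) ≤ 1 := by
      rw [show (C (2 : ℤ) : MvPolynomial σ ℤ) = 1 + 1 by rw [← C_1, ← C_add]; norm_num]
      have := constantFreeComplexity_add_le (1 : MvPolynomial σ ℤ) 1
      rw [constantFreeComplexity_one] at this
      simpa using this
    calc constantFreeComplexity (C ((2 : ℤ) ^ m) * C (2 : ℤ) : MvPolynomial σ ℤ)
        ≤ constantFreeComplexity (C ((2 : ℤ) ^ m) : MvPolynomial σ ℤ) +
            constantFreeComplexity (C (2 : ℤ) : MvPolynomial σ ℤ) + 1 :=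
          constantFreeComplexity_mul_le _ _
      _ ≤ (2 * m + 1) + 1 + 1 := by omega
      _ = 2 * (m + 1) + 1 := by ring

/-- `τ((−2)^m) ≤ 2m + 2` (negate `2^m` if `m` is odd). -/
theorem constantFreeComplexity_C_neg_two_pow_le {σ : Type*} (m : ℕ) :
    constantFreeComplexity (C ((-2 : ℤ) ^ m) : MvPolynomial σ ℤ) ≤ 2 * m + 2 := by
  refine (constantFreeComplexity_C_le_natAbs_succ _).trans ?_
  rw [Int.natAbs_pow, show (-2 : ℤ).natAbs = 2 by rfl, Nat.cast_pow, Nat.cast_ofNat]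
  have := constantFreeComplexity_C_two_pow_le (σ := σ) m
  omega

/-- Cost of the alternating jet sum: `τ(Σ_{j<a} (−2)^j F_j) ≤ Σ_{j<a} (τ(F_j) + 2j + 4)`. -/
theorem constantFreeComplexity_jetSum_le {σ : Type*} (F : ℕ → MvPolynomial σ ℤ) (a : ℕ) :
    constantFreeComplexity (∑ j ∈ Finset.range a, ((-2 : ℤ) ^ j) • F j) ≤
      ∑ j ∈ Finset.range a, (constantFreeComplexity (F j) + 2 * j + 4) := by
  induction a with
  | zero => simp [constantFreeComplexity_zero]
  | succ a ih =>
    rw [Finset.sum_range_succ, Finset.sum_range_succ]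
    have hsm : constantFreeComplexity (((-2 : ℤ) ^ a) • F a) ≤ constantFreeComplexity (F a) + 2 * a + 3 := by
      rw [MvPolynomial.smul_eq_C_mul]
      calc constantFreeComplexity (C ((-2 : ℤ) ^ a) * F a)
          ≤ constantFreeComplexity (C ((-2 : ℤ) ^ a) : MvPolynomial σ ℤ) +
              constantFreeComplexity (F a) + 1 := constantFreeComplexity_mul_le _ _
        _ ≤ (2 * a + 2) + constantFreeComplexity (F a) + 1 := by
            gcongr; exact constantFreeComplexity_C_neg_two_pow_le a
        _ = constantFreeComplexity (F a) + 2 * a + 3 := by ring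
    calc constantFreeComplexity ((∑ j ∈ Finset.range a, ((-2 : ℤ) ^ j) • F j) + ((-2 : ℤ) ^ a) • F a)
        ≤ constantFreeComplexity (∑ j ∈ Finset.range a, ((-2 : ℤ) ^ j) • F j) +
            constantFreeComplexity (((-2 : ℤ) ^ a) • F a) + 1 := constantFreeComplexity_add_le _ _
      _ ≤ (∑ j ∈ Finset.range a, (constantFreeComplexity (F j) + 2 * j + 4)) +
            (constantFreeComplexity (F a) + 2 * a + 3) + 1 := by gcongr
      _ = _ := by ring

/-! ### The exponent bookkeeping -/

/-- The size estimate: for `n ≥ 70 (k+2)^3` and `A ≤ 4(n+1)^4 + k n^c + (2k² + 4k)`,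
`(A + 1)(2 + 65 (k+2)^3) ≤ n^{c+7}`. -/
theorem size_le_pow {n k c A : ℕ} (hn : 70 * (k + 2) ^ 3 ≤ n)
    (hA : A ≤ 4 * (n + 1) ^ 4 + k * n ^ c + (2 * k ^ 2 + 4 * k)) :
    (A + 1) * (2 + 65 * (k + 2) ^ 3) ≤ n ^ (c + 7) := by
  have hk2 : 1 ≤ (k + 2) ^ 3 := Nat.one_le_pow _ _ (by omega)
  have hn64 : 64 ≤ n := by nlinarith
  have hkn : k ≤ n := by nlinarith [Nat.le_self_pow (by norm_num : 3 ≠ 0) (k + 2)]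
  have hn1 : 1 ≤ n := by omega
  -- the gate cost is at most `n`
  have hgate : 2 + 65 * (k + 2) ^ 3 ≤ n := by omega
  -- `4 (n+1)^4 ≤ n^5`
  have h4 : 4 * (n + 1) ^ 4 ≤ n ^ 5 := by
    have : (n + 1) ^ 4 ≤ (2 * n) ^ 4 := Nat.pow_le_pow_left (by omega) 4
    calc 4 * (n + 1) ^ 4 ≤ 4 * (2 * n) ^ 4 := by omega
      _ = 64 * n ^ 4 := by ring
      _ ≤ n * n ^ 4 := Nat.mul_le_mul_right _ hn64
      _ = n ^ 5 := by ring
  -- `k n^c ≤ n^{c+1}`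
  have hkc : k * n ^ c ≤ n ^ (c + 1) :=
    calc k * n ^ c ≤ n * n ^ c := Nat.mul_le_mul_right _ hkn
      _ = n ^ (c + 1) := by ring
  -- `2k² + 4k + 1 ≤ n²`
  have hk' : 2 * k ^ 2 + 4 * k + 1 ≤ n ^ 2 := by
    have : (k + 2) ^ 3 ≤ n := le_trans (by omega) hn
    have h' : (k + 2) ^ 2 ≤ (k + 2) ^ 3 := Nat.pow_le_pow_right (by omega) (by norm_num)
    nlinarith
  -- powers are monotone in the exponent
  have hp5 : n ^ 5 ≤ n ^ (c + 5) := Nat.pow_le_pow_right hn1 (by omega)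
  have hpc : n ^ (c + 1) ≤ n ^ (c + 5) := Nat.pow_le_pow_right hn1 (by omega)
  have hp2 : n ^ 2 ≤ n ^ (c + 5) := Nat.pow_le_pow_right hn1 (by omega)
  have hA1 : A + 1 ≤ 3 * n ^ (c + 5) := by omega
  have h3 : 3 * n ^ (c + 5) ≤ n ^ (c + 6) :=
    calc 3 * n ^ (c + 5) ≤ n * n ^ (c + 5) := Nat.mul_le_mul_right _ (by omega)
      _ = n ^ (c + 6) := by ring
  calc (A + 1) * (2 + 65 * (k + 2) ^ 3) ≤ n ^ (c + 6) * n :=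
        Nat.mul_le_mul (hA1.trans h3) hgate
    _ = n ^ (c + 7) := by ring

/-! ### The item -/

set_option maxHeartbeats 800000 in
/-- **`BooleanShadowToCF` (stmt-ValiantsHypothesis-16744):** `PerModPowBooleanHard →
ConstantFreeJetGrowth`, by contraposition: cheap jets for every fixed order would give, through
`TwoAdicShadow` and Bürgisser's simulation modulo `2^k`, polynomial-size Boolean circuits for the
`k` low bits of the `0/1` permanent, for every `k`. -/
theorem booleanShadowToCF_proof : Theses.AnyonJets.BooleanShadowToCF := by
  unfold Theses.AnyonJets.BooleanShadowToCF Theses.AnyonJets.ConstantFreeJetGrowth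
  intro hHard
  -- abbreviate the jets
  set J : (n k : ℕ) → MvPolynomial (Fin n × Fin n) ℤ := fun (n k : ℕ) =>
    (∑ σ : Equiv.Perm (Fin n), MvPolynomial.C (((Equiv.Perm.sign σ : ℤˣ) : ℤ) *
      (((Finset.univ.filter (fun p : Fin n × Fin n => p.1 < p.2 ∧ σ p.2 < σ p.1)).card.choose k : ℕ) : ℤ)) *
      ∏ i : Fin n, MvPolynomial.X (σ i, i) : MvPolynomial (Fin n × Fin n) ℤ) with hJ
  by_contra hCF
  simp only [not_forall, not_exists, not_and, not_le] at hCF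
  obtain ⟨c, hc⟩ := hCF
  -- `hc : ∀ k, 1 ≤ k → ∃ n₀, ∀ n, n₀ ≤ n → τ (J n k) < n ^ c`
  obtain ⟨k, hk1, hk⟩ := hHard (c + 7)
  -- thresholds for the jets `1 ≤ j < k`
  have hthr : ∀ j : ℕ, ∃ n₀ : ℕ, 1 ≤ j → ∀ n, n₀ ≤ n → constantFreeComplexity (J n j) < n ^ c := by
    intro j
    by_cases hj : 1 ≤ j
    · obtain ⟨n₀, hn₀⟩ := hc j hj
      exact ⟨n₀, fun _ => hn₀⟩
    · exact ⟨0, fun h => absurd h hj⟩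
  choose N₀ hN₀ using hthr
  obtain ⟨n, hn, hnot⟩ := hk (max ((Finset.range k).sup N₀) (70 * (k + 2) ^ 3))
  apply hnot
  have hnN : ∀ j, j < k → N₀ j ≤ n := fun j hj =>
    le_trans (Finset.le_sup (Finset.mem_range.mpr hj)) (le_trans (le_max_left _ _) hn)
  have hn70 : 70 * (k + 2) ^ 3 ≤ n := le_trans (le_max_right _ _) hn
  -- the `j = 0` jet is the determinant
  have hJ0 : J n 0 = detPoly (Fin n) ℤ := by
    rw [hJ, detPoly_eq_sum]
    refine Finset.sum_congr rfl fun σ _ => ?_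
    simp
  -- the jet sum `S = Σ_{j<k} (−2)^j J_{n,j}` and its constant-free cost
  set S : MvPolynomial (Fin n × Fin n) ℤ := ∑ j ∈ Finset.range k, ((-2 : ℤ) ^ j) • J n j with hS
  have hτS : constantFreeComplexity S ≤ 4 * (n + 1) ^ 4 + k * n ^ c + (2 * k ^ 2 + 4 * k) := by
    refine (constantFreeComplexity_jetSum_le (J n) k).trans ?_
    have hterm : ∀ j ∈ Finset.range k, constantFreeComplexity (J n j) + 2 * j + 4 ≤
        (if j = 0 then 4 * (n + 1) ^ 4 else n ^ c) + (2 * k + 4) := by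
      intro j hj
      have hjk : j < k := Finset.mem_range.mp hj
      by_cases hj0 : j = 0
      · subst hj0
        rw [if_pos rfl, hJ0]
        have := constantFreeComplexity_detPoly_le n
        omega
      · rw [if_neg hj0]
        have := hN₀ j (by omega) n (hnN j hjk)
        omega
    refine (Finset.sum_le_sum hterm).trans ?_
    rw [Finset.sum_add_distrib, Finset.sum_const, Finset.card_range, smul_eq_mul]
    have hsplit : ∑ j ∈ Finset.range k, (if j = 0 then 4 * (n + 1) ^ 4 else n ^ c) ≤
        4 * (n + 1) ^ 4 + k * n ^ c := by
      rw [Finset.sum_ite, Finset.sum_const, Finset.sum_const, smul_eq_mul, smul_eq_mul]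
      have h1 : ((Finset.range k).filter (fun j => j = 0)).card ≤ 1 := by
        refine (Finset.card_le_one_iff).mpr ?_
        intro a b ha hb
        rw [Finset.mem_filter] at ha hb
        rw [ha.2, hb.2]
      have h2 : ((Finset.range k).filter (fun j => ¬ j = 0)).card ≤ k :=
        (Finset.card_filter_le _ _).trans (by simp)
      nlinarith [Nat.zero_le (4 * (n + 1) ^ 4), Nat.zero_le (n ^ c)]
    nlinarith [hsplit]
  -- an optimal constant-free circuit for `S`, simulated modulo `2^k`
  obtain ⟨P, hP2, hPc, hPe, hPs⟩ := exists_computes_size_eq_constantFreeComplexity S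
  haveI : NeZero (2 ^ k) := ⟨pow_ne_zero _ two_ne_zero⟩
  have hsim := cktSize_testBits_aeval_eval (p := 2 ^ k) (ℓ := k) le_rfl
    (fun (y : Fin n × Fin n → Bool) (v : Fin n × Fin n) => if y v then (1 : ZMod (2 ^ k)) else 0)
    (fun v => cktSize_inputResidue hk1 v) P hP2
  -- `S ≡ per (mod 2^k)`, and `per(y)` counts the permutations supported on `y`
  obtain ⟨R, hR⟩ := twoAdicShadow_proof n k
  have hval : ∀ y : Fin n × Fin n → Bool,
      aeval (fun v => if y v then (1 : ZMod (2 ^ k)) else 0) P.eval = (permCount n y : ZMod (2 ^ k)) := by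
    intro y
    have hPe' : P.eval = S := hPe
    have hSeq : S = perPoly (Fin n) ℤ - ((2 : ℤ) ^ k) • R := by
      rw [hS]; rw [← hR]; ring
    rw [hPe', hSeq, map_sub, aeval_perPoly_bool, MvPolynomial.smul_eq_C_mul, map_mul,
      MvPolynomial.aeval_C, map_pow, map_ofNat]
    have h2k : ((2 : ZMod (2 ^ k)) ^ k) = 0 := by
      have := ZMod.natCast_self (2 ^ k)
      push_cast at this
      exact this
    rw [h2k, zero_mul, sub_zero]
  refine (hsim.congr fun y i => ?_).of_le ?_
  · rw [hval y, ZMod.val_natCast, testBits_mod, testBits_apply]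
    rfl
  · rw [hPs]
    exact le_trans (Nat.mul_le_mul_left _ (gateCost_le k 1)) (by
      simpa [Nat.mul_one] using size_le_pow (c := c) hn70 hτS)

end Summit.ValiantsHypothesis.ValiantsHypothesis.Theorems.AnyonJets
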